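import Literature.Analysis.FluidPDE.TypeIAncientMild
import Literature.Analysis.FluidPDE.SelfSimilar
import Summits.NavierStokesRegularity.NavierStokesRegularity.Theorems.SymmetryModuliCountFarPastLedgerReduction
import HarnessLib

/-! # A normalised Oseen-gauge profile restricts to a `G`-cell with `L⁴` datum — crux stmt-NavierStokesRegularity-1404 (`QuantisedSymmetry.PolyhedralDssProfileExists`), line polyhedral_cell, stub stub_cellOfRepresentative

Registered stub `stub_cellOfRepresentative` (`--supports stmt-NavierStokesRegularity-1404`), the
last step of the converse `crux ⇒ polyhedral cell`. Let `V` be an Oseen-gauge Type-I field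
(`IsTypeIAncientMild C V`), exactly `c`-DSS (`1 < c`), with the Type-I space–time bound
`HasTypeIDecay C₀ V`, `G`-equivariant, and nonzero at some `(t₀, x₀)` with `t₀ < 0`.

Proof. Put `l = √(−t₀)` (`l > 0`, `l² = −t₀`) and `v = nsRescale l V`, `v t x = l V(l² t, l x)`.
* `v` is again Oseen-gauge Type-I with the same constant (`isTypeIAncientMild_nsRescale`), has the
  same space–time bound (`HasTypeIDecay.nsRescale`), is exactly `c`-DSS (scalings commute:
  `nsRescale c (nsRescale l V) = nsRescale l (nsRescale c V)`, `nsRescale_mul`) and `G`-equivariant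
  (the isometries `g` are linear), and `v (−1) (l⁻¹ x₀) = l V t₀ x₀ ≠ 0`.
* On the model period `[-1, -c⁻²] × ℝ³ ⊂ (−∞, 0) × ℝ³` the `IsTypeIAncientMild` API gives the cell
  clauses: joint continuity (`continuousOn_uncurry`), the bound `‖v‖ ≤ C/√(−t) ≤ C c`
  (`norm_le`, `√(−t) ≥ c⁻¹`), weak divergence-freeness (`isWeaklyDivFree`), the Oseen identity
  between model times (`mild_eq`), the zoom clause (the DSS identity evaluated at `t = −c⁻²`) and
  equivariance.
* The datum `v(−1)` is continuous with `‖v(−1, x)‖ ≤ C₀/(‖x‖ + 1)`, so `‖v(−1)‖⁴ ≤ C₀⁴ (1 + ‖x‖)⁻⁴`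
  is integrable on `ℝ³` (`integrable_one_add_norm`, `4 > 3 = dim`), i.e. `v(−1) ∈ L⁴`; and a
  continuous function which is a.e. zero is zero (`Continuous.ae_eq_iff_eq`), contradicting
  `v(−1)(l⁻¹ x₀) ≠ 0`.
-/

noncomputable section

-- the summit namespace `…NavierStokesRegularity.NavierStokesRegularity…` is the tree convention (D-0017)
set_option linter.dupNamespace false

namespace Summit.NavierStokesRegularity.NavierStokesRegularity.Theorems.PolyhedralDssProfileExists.PolyhedralCell

open MeasureTheory Set Function Filter Topology
open scoped ENNReal NNReal
open Literature.Analysis.FluidPDE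

/-- **Stub B: a normalised Oseen-gauge profile restricts to a `G`-cell with `L⁴` datum.** Let `V` be
an Oseen-gauge Type-I field (`IsTypeIAncientMild C V`), exactly `c`-DSS (`c > 1`), with the
space–time bound `HasTypeIDecay C₀ V`, `G`-equivariant, and nonzero at some `(t₀, x₀)`, `t₀ < 0`.
Then the parabolic rescaling `v = nsRescale √(−t₀) V` restricted to the model period
`[-1, -c⁻²] × ℝ³` is a `G`-cell (jointly continuous, bounded by `C·c`, weakly divergence free,
Oseen-mild between model times, closing up under the zoom, `G`-equivariant) whose datum `v(−1)` is
in `L⁴(ℝ³)` and not a.e. zero. [folklore; Bradshaw–Tsai 2017 §1 (period map), KNSS 2009 §4] -/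
theorem stub_cellOfRepresentative :
    ∀ (G : Subgroup (EuclideanSpace ℝ (Fin 3) ≃ₗᵢ[ℝ] EuclideanSpace ℝ (Fin 3))) (c : ℝ)
      (V : ℝ → EuclideanSpace ℝ (Fin 3) → EuclideanSpace ℝ (Fin 3)) (C C₀ t₀ : ℝ)
      (x₀ : EuclideanSpace ℝ (Fin 3)),
      1 < c → IsTypeIAncientMild C V → IsDiscretelySelfSimilar c V → HasTypeIDecay C₀ V →
      (∀ g ∈ G, ∀ t x, V t (g x) = g (V t x)) → t₀ < 0 → V t₀ x₀ ≠ 0 →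
      ∃ v : ℝ → EuclideanSpace ℝ (Fin 3) → EuclideanSpace ℝ (Fin 3),
        (ContinuousOn (Function.uncurry v) (Set.Icc (-1 : ℝ) (-(c ^ 2)⁻¹) ×ˢ Set.univ) ∧
          (∃ M : ℝ, ∀ t ∈ Set.Icc (-1 : ℝ) (-(c ^ 2)⁻¹), ∀ x, ‖v t x‖ ≤ M) ∧
          (∀ t ∈ Set.Icc (-1 : ℝ) (-(c ^ 2)⁻¹), IsWeaklyDivFree (v t)) ∧
          (∀ s t : ℝ, -1 ≤ s → s < t → t ≤ -(c ^ 2)⁻¹ → ∀ x,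
            v t x = heatFlow (v s) (t - s) x - oseenDuhamel 1 s v v t x) ∧
          (∀ x, v (-(c ^ 2)⁻¹) x = c • v (-1) (c • x)) ∧
          (∀ g ∈ G, ∀ t ∈ Set.Icc (-1 : ℝ) (-(c ^ 2)⁻¹), ∀ x, v t (g x) = g (v t x))) ∧
        MemLp (v (-1)) 4 volume ∧ ¬ (v (-1) =ᵐ[volume] 0) := by
  intro G c V C C₀ t₀ x₀ hc hV hdss hdec hG ht₀ hx₀
  -- the normalising scale `l = √(-t₀)`
  obtain ⟨l, hl, hl2⟩ : ∃ l : ℝ, 0 < l ∧ l ^ 2 = -t₀ :=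
    ⟨Real.sqrt (-t₀), Real.sqrt_pos.2 (by linarith), Real.sq_sqrt (by linarith)⟩
  have hc0 : 0 < c := by linarith
  have hc2 : 0 < c ^ 2 := by positivity
  have hT : -(c ^ 2)⁻¹ < (0 : ℝ) := neg_lt_zero.2 (inv_pos.2 hc2)
  -- the rescaled field and its structural properties
  have hv : IsTypeIAncientMild C (nsRescale l V) := isTypeIAncientMild_nsRescale hV hl
  have hvdec : HasTypeIDecay C₀ (nsRescale l V) := hdec.nsRescale hl
  have hdss' : nsRescale c V = V := hdss
  have hvdss : nsRescale c (nsRescale l V) = nsRescale l V := by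
    rw [← nsRescale_mul l c V, mul_comm l c, nsRescale_mul c l V, hdss']
  have hvG : ∀ g ∈ G, ∀ t x, nsRescale l V t (g x) = g (nsRescale l V t x) := by
    intro g hg t x
    simp only [nsRescale_apply]
    rw [← map_smul g l x, hG g hg, map_smul]
  have hm1 : (-1 : ℝ) < 0 := by norm_num
  have hcont : Continuous (nsRescale l V (-1)) := hv.continuous_slice hm1
  have hne : nsRescale l V (-1) (l⁻¹ • x₀) ≠ 0 := by
    rw [nsRescale_apply, smul_inv_smul₀ hl.ne', show l ^ 2 * (-1) = t₀ by rw [hl2]; ring]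
    exact smul_ne_zero hl.ne' hx₀
  refine ⟨nsRescale l V, ⟨?_, ?_, ?_, ?_, ?_, ?_⟩, ?_, ?_⟩
  · -- joint continuity on the closed model slab (inside the open past)
    exact hv.continuousOn_uncurry.mono
      (prod_mono (fun t ht => lt_of_le_of_lt ht.2 hT) subset_rfl)
  · -- uniform bound `C / √(-t) ≤ C c` on the slab
    refine ⟨C * c, fun t ht x => ?_⟩
    have ht0 : t < 0 := lt_of_le_of_lt ht.2 hT
    have hCnn : 0 ≤ C := hv.nonneg
    have hsqrt_pos : 0 < Real.sqrt (-t) := Real.sqrt_pos.2 (by linarith)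
    have hsqrt : c⁻¹ ≤ Real.sqrt (-t) := by
      rw [show c⁻¹ = Real.sqrt ((c ^ 2)⁻¹) by rw [Real.sqrt_inv, Real.sqrt_sq hc0.le]]
      exact Real.sqrt_le_sqrt (by linarith [ht.2])
    refine (hv.norm_le ht0 x).trans ?_
    rw [div_le_iff₀ hsqrt_pos]
    have h1 : 1 ≤ c * Real.sqrt (-t) := by
      calc (1 : ℝ) = c * c⁻¹ := (mul_inv_cancel₀ hc0.ne').symm
        _ ≤ c * Real.sqrt (-t) := by gcongr
    calc C = C * 1 := (mul_one C).symm
      _ ≤ C * (c * Real.sqrt (-t)) := by gcongr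
      _ = C * c * Real.sqrt (-t) := by ring
  · -- weakly divergence free slices
    exact fun t ht => hv.isWeaklyDivFree (lt_of_le_of_lt ht.2 hT)
  · -- the Oseen integral equation between model times
    exact fun s t _ hst htT x => hv.mild_eq hst (lt_of_le_of_lt htT hT) x
  · -- the zoom clause: the DSS identity at `t = -c⁻²`
    intro x
    have key := congrFun (congrFun hvdss (-(c ^ 2)⁻¹)) x
    rw [nsRescale_apply c (nsRescale l V)] at key
    rw [← key, show c ^ 2 * -(c ^ 2)⁻¹ = (-1 : ℝ) by rw [mul_neg, mul_inv_cancel₀ hc2.ne']]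
  · -- equivariance on the slab
    exact fun g hg t _ x => hvG g hg t x
  · -- the datum `v(-1)` is in `L⁴`: `‖v(-1,x)‖⁴ ≤ C₀⁴ (1 + ‖x‖)⁻⁴`, integrable since `4 > 3`
    have hbound : ∀ x, ‖nsRescale l V (-1) x‖ ≤ C₀ / (‖x‖ + 1) := fun x => by
      simpa only [neg_neg, Real.sqrt_one] using hvdec (-1) hm1 x
    have hdom : Integrable
        (fun x : EuclideanSpace ℝ (Fin 3) => C₀ ^ 4 * (1 + ‖x‖) ^ (-(4 : ℝ))) volume :=
      (integrable_one_add_norm (by rw [finrank_euclideanSpace_fin]; norm_num)).const_mul _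
    rw [← integrable_norm_rpow_iff hcont.aestronglyMeasurable (by norm_num) ENNReal.ofNat_ne_top,
      ENNReal.toReal_ofNat]
    refine hdom.mono'
      ((hcont.norm.rpow_const fun _ => Or.inr (by norm_num)).aestronglyMeasurable)
      (Eventually.of_forall fun x => ?_)
    show ‖‖nsRescale l V (-1) x‖ ^ (4 : ℝ)‖ ≤ C₀ ^ 4 * (1 + ‖x‖) ^ (-(4 : ℝ))
    rw [Real.norm_of_nonneg (Real.rpow_nonneg (norm_nonneg _) _), Real.rpow_ofNat,
      Real.rpow_neg (by positivity), Real.rpow_ofNat, add_comm (1 : ℝ), ← div_eq_mul_inv,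
      ← div_pow]
    exact pow_le_pow_left₀ (norm_nonneg _) (hbound x) 4
  · -- `v(-1)` is continuous and nonzero at `l⁻¹ x₀`, hence not a.e. zero
    intro h0
    have heq : nsRescale l V (-1) = 0 := (hcont.ae_eq_iff_eq volume continuous_const).1 h0
    rw [heq] at hne
    exact hne rfl

end Summit.NavierStokesRegularity.NavierStokesRegularity.Theorems.PolyhedralDssProfileExists.PolyhedralCell

end
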